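import Summits.CriticalPhenomena.PercolationContinuityZ3.Theorems.PercNearOneGluingNoHeavyLowerTailSunflowerTracePartition
import Summits.CriticalPhenomena.PercolationContinuityZ3.Theorems.PercNearOneGluingNoHeavyLowerTailSunflowerPrincipalPetal
import HarnessLib

/-!
# `NoHeavyLowerTail` (crux stmt-CriticalPhenomena-4575), abstract sunflower cubic: ★ (`0 ≤ ZH`) for every sunflower with a DISJUNCTIVE petal

Support file (seat `prim-ineq-gen-2` gen 22; `--supports stmt-CriticalPhenomena-4575`).  Nothing is asserted about the crux; no `sorry`, no named facts.
Memo: run/shared/lean/prim/prim-ineq-gen-2/SPECTATOR-TRANSFER-GEN22.md §7.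

THE CLASS.  A petal of the sunflower `F` (label `3`, i.e. `V 2 ∖ A`) is DISJUNCTIVE (an "OR-petal") when for some nonempty `S₀` it consists exactly of the
non-kernel sets meeting `S₀`: every set meeting `S₀` has label `3` or `4`, and every set of label `3` meets `S₀` (`Sunflower.IsOrPetal`).  Equivalently
`F = θ(U, V, OR_{S₀})` for arbitrary up-sets `U, V` and the up-set `OR_{S₀} = {S : S ∩ S₀ ≠ ∅}`.  For `|S₀| = 1` this is a sub-case of the centred petal
(`…SunflowerCenteredPetal`); for `|S₀| ≥ 2` the petal is in general NEITHER INTERSECTING NOR CENTRED (it may contain the disjoint singletons of `S₀`), so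
the class is outside `…SunflowerHallGladkovProof` / `…SunflowerCenteredPetal`; examples: `θ(h₁, h₂, x_s ∨ x_t)`, the doubled triangle, `θ(U,V,OR)` with
`U, V` reading `S₀` arbitrarily.

THEOREMS `Sunflower.ZH_nonneg_of_isOrPetal` (petal `3`) and `Sunflower.ZH_nonneg_of_orPetal_label` (any petal label `ℓ ∈ {1,2,3}`, via the tree's
cyclic relabelling `Sunflower.rotate`): ★ holds for every sunflower with a disjunctive petal.

PROOF (memo §7; a two-copy argument after peeling `S₀`).  Regroup the ordered 3-partitions of the ground type by the traces of the blocks on `S₀`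
(`sum_parts_eq_sum_traces`, `sum_parts_trace_eq`): for a trace `s` the partitions are `(X ∪ s₁, Y ∪ s₂, Z ∪ s₃)` with `(X,Y,Z)` an ordered 3-partition of
`S₀ᶜ`.  A block meeting `S₀` has label in `{3,4}`, a block inside `S₀ᶜ` has label in `{0,1,2,4}`, and a block `X ∪ σ` (`σ ≠ ∅`) has label `4` as soon as
`lab X ≠ 0` (monotonicity).  (iii) All three traces nonempty: every term is `0`.  (ii) Exactly two nonempty (`traceSum_two_nonneg`): the terms are
`2·[x = 0, λ = λ' = 4] − [x petal, λ ≠ λ']`; a negative term forces the `3`-labelled block to have an all-bottom free part, and the block swaps of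
`partsOf S₀ᶜ` inject these into the positive terms.  (i) `S₀` inside one block (`traceSum_one_nonneg`): the terms are bounded below by indicators of the
free-part labels; the `(C₁,C₂)` debt is paid by antipodal Gladkov on every window (`sum_partsOf_kk_nonneg`), the `(C, A/B)` debts behind a `3`-labelled
block and the Gladkov loan are repaid by `(A,B,A)`/`(A,A,B)`-type terms through block rotations; what is left is `#{(B,A,·≠B)} + #{(A,B,·≠B)} ≥ 0`.
-/

namespace Summit.CriticalPhenomena.PercolationContinuityZ3.Theorems.SunflowerPartition

open Finset

/-! ## Pointwise kernel facts on `M₃ = Fin 5` (all by `decide`) -/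

/-- Three labels in `{3,4}` give `s6H = 0`. [this work] -/
theorem s6H_eq_zero_of_ge3 : ∀ x y z : Fin 5, (x = 3 ∨ x = 4) → (y = 3 ∨ y = 4) → (z = 3 ∨ z = 4) → s6H x y z = 0 := by decide

/-- Case (ii) pointwise bound: first block free (`x ≠ 3`), the other two of the form `Y ∪ σ`, `Z ∪ τ` with labels `l, l' ∈ {3,4}` above the free-part
labels `y, z ∉ {3}` (monotonicity `y ≤ l`, `z ≤ l'`). [this work] -/
theorem s6H_ge_case_two : ∀ x y z l l' : Fin 5, x ≠ 3 → y ≠ 3 → z ≠ 3 → (l = 3 ∨ l = 4) → (l' = 3 ∨ l' = 4) →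
    (y = l ∨ y = 0 ∨ l = 4) → (z = l' ∨ z = 0 ∨ l' = 4) →
    2 * (if x = 0 ∧ l = 4 ∧ l' = 4 then (1 : ℤ) else 0)
      - (if (x = 1 ∨ x = 2) ∧ l = 4 ∧ z = 0 then (1 : ℤ) else 0)
      - (if (x = 1 ∨ x = 2) ∧ l' = 4 ∧ y = 0 then (1 : ℤ) else 0) ≤ s6H x l l' := by
  decide

/-- Case (ii): a swapped debt sits inside a positive term (a petal-labelled free part forces label `4` on its block). [this work] -/
theorem case_two_move : ∀ x z ly lz : Fin 5, (lz = 3 ∨ lz = 4) → (z = lz ∨ z = 0 ∨ lz = 4) →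
    (if (z = 1 ∨ z = 2) ∧ ly = 4 ∧ x = 0 then (1 : ℤ) else 0)
      ≤ (if z ≠ 0 ∧ z ≠ 3 ∧ z ≠ 4 ∧ ly = 4 ∧ x = 0 ∧ lz = 4 then (1 : ℤ) else 0) := by
  decide

/-- Case (ii) repayment, pointwise: `[x = 0, l = 4, l' = 4]·([z petal] + [y petal]) ≤ 2·[x = 0, l = 4, l' = 4]`. [this work] -/
theorem case_two_repay : ∀ x y z l l' : Fin 5,
    (if z ≠ 0 ∧ z ≠ 3 ∧ z ≠ 4 ∧ l = 4 ∧ x = 0 ∧ l' = 4 then (1 : ℤ) else 0)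
      + (if y ≠ 0 ∧ y ≠ 3 ∧ y ≠ 4 ∧ l' = 4 ∧ x = 0 ∧ l = 4 then (1 : ℤ) else 0)
      ≤ 2 * (if x = 0 ∧ l = 4 ∧ l' = 4 then (1 : ℤ) else 0) := by
  decide

/-- Case (i) pointwise bound: two free blocks (`x, y ≠ 3`), third block `Z ∪ S₀` with label `l ∈ {3,4}` above the free-part label `z ≠ 3`. [this work] -/
theorem s6H_ge_case_one : ∀ x y z l : Fin 5, x ≠ 3 → y ≠ 3 → z ≠ 3 → (l = 3 ∨ l = 4) → (z = l ∨ z = 0 ∨ l = 4) →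
    2 * (if x = 0 ∧ y = 4 ∧ z ≠ 0 then (1 : ℤ) else 0) + 2 * (if x = 4 ∧ y = 0 ∧ z ≠ 0 then (1 : ℤ) else 0)
      + 2 * (if x = 0 ∧ y = 0 ∧ z ≠ 0 then (1 : ℤ) else 0)
      - (if x ≠ 0 ∧ x ≠ 4 ∧ y ≠ 0 ∧ y ≠ 4 ∧ x ≠ y then (1 : ℤ) else 0)
      - (if (x = 1 ∨ x = 2) ∧ (y = 0 ∨ y = 4) ∧ z = 0 then (1 : ℤ) else 0)
      - (if (x = 0 ∨ x = 4) ∧ (y = 1 ∨ y = 2) ∧ z = 0 then (1 : ℤ) else 0) ≤ s6H x y l := by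
  decide

/-- `kk` as indicators, with the `(A,B)` / `(B,A)` pairs split by a third label `z`. [this work] -/
theorem kk_split : ∀ x y z : Fin 5, kk x y =
    (if x = 4 ∧ y = 0 ∧ z ≠ 0 then (1 : ℤ) else 0) + (if x = 4 ∧ y = 0 ∧ z = 0 then (1 : ℤ) else 0)
      + (if x = 0 ∧ y = 4 ∧ z ≠ 0 then (1 : ℤ) else 0) + (if x = 0 ∧ y = 4 ∧ z = 0 then (1 : ℤ) else 0)
      - (if x ≠ 0 ∧ x ≠ 4 ∧ y ≠ 0 ∧ y ≠ 4 ∧ x ≠ y then (1 : ℤ) else 0) := by decide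

/-- Splitting the `(C, A∪B, ·)` debt by the second label. [this work] -/
theorem debt_split_D : ∀ x y z : Fin 5,
    (if (x = 1 ∨ x = 2) ∧ (y = 0 ∨ y = 4) ∧ z = 0 then (1 : ℤ) else 0)
      = (if (x = 1 ∨ x = 2) ∧ y = 4 ∧ z = 0 then (1 : ℤ) else 0) + (if (x = 1 ∨ x = 2) ∧ y = 0 ∧ z = 0 then (1 : ℤ) else 0) := by
  decide

/-- Splitting the `(A∪B, C, ·)` debt by the first label. [this work] -/
theorem debt_split_E : ∀ x y z : Fin 5,
    (if (x = 0 ∨ x = 4) ∧ (y = 1 ∨ y = 2) ∧ z = 0 then (1 : ℤ) else 0)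
      = (if x = 4 ∧ (y = 1 ∨ y = 2) ∧ z = 0 then (1 : ℤ) else 0) + (if x = 0 ∧ (y = 1 ∨ y = 2) ∧ z = 0 then (1 : ℤ) else 0) := by
  decide

/-- Case (i) repayment, pointwise in the free-part labels `(x, y, z)`, `z ≠ 3`, after the debts have been rotated onto the third block. [this work] -/
theorem case_one_repay : ∀ x y z : Fin 5, z ≠ 3 →
    (if z = 4 ∧ x = 0 ∧ y = 0 then (1 : ℤ) else 0) + (if x = 0 ∧ z = 4 ∧ y = 0 then (1 : ℤ) else 0)
      + (if (z = 1 ∨ z = 2) ∧ x = 4 ∧ y = 0 then (1 : ℤ) else 0) + (if (z = 1 ∨ z = 2) ∧ x = 0 ∧ y = 0 then (1 : ℤ) else 0)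
      + (if y = 4 ∧ (z = 1 ∨ z = 2) ∧ x = 0 then (1 : ℤ) else 0) + (if x = 0 ∧ (z = 1 ∨ z = 2) ∧ y = 0 then (1 : ℤ) else 0)
      ≤ (if x = 0 ∧ y = 4 ∧ z ≠ 0 then (1 : ℤ) else 0) + (if x = 4 ∧ y = 0 ∧ z ≠ 0 then (1 : ℤ) else 0)
        + 2 * (if x = 0 ∧ y = 0 ∧ z ≠ 0 then (1 : ℤ) else 0) := by
  decide

namespace Sunflower

variable {α : Type*} [DecidableEq α] (F : Sunflower α)

/-- The petal of label `3` is DISJUNCTIVE with support `S₀`: `S₀ ≠ ∅`, every set meeting `S₀` has label `3` or `4`, every label-`3` set meets `S₀`. [this work] -/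
def IsOrPetal (S₀ : Finset α) : Prop :=
  S₀.Nonempty ∧ (∀ S : Finset α, (S ∩ S₀).Nonempty → F.lab S = 3 ∨ F.lab S = 4) ∧ (∀ S : Finset α, F.lab S = 3 → (S ∩ S₀).Nonempty)

section facts

variable {F} {S₀ : Finset α} (h : F.IsOrPetal S₀)
include h

/-- A set inside a family disjoint from `S₀` is not a petal-`3` set. [this work] -/
theorem lab_ne_three_of_subset {X W : Finset α} (hW : Disjoint W S₀) (hX : X ⊆ W) : F.lab X ≠ 3 := by
  intro h3
  obtain ⟨x, hx⟩ := h.2.2 X h3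
  rw [mem_inter] at hx
  exact Finset.disjoint_left.1 hW (hX hx.1) hx.2

/-- A set `X ∪ σ` with `∅ ≠ σ ⊆ S₀` has label `3` or `4`. [this work] -/
theorem lab_union_ge_three {σ : Finset α} (hσ : σ ⊆ S₀) (hne : σ.Nonempty) (X : Finset α) :
    F.lab (X ∪ σ) = 3 ∨ F.lab (X ∪ σ) = 4 := by
  refine h.2.1 _ ?_
  obtain ⟨x, hx⟩ := hne
  exact ⟨x, mem_inter.2 ⟨mem_union_right _ hx, hσ hx⟩⟩

end facts

/-- Monotonicity between the free part and the block: `lab X = lab (X ∪ σ) ∨ lab X = 0 ∨ lab (X ∪ σ) = 4`. [this work] -/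
theorem lab_mono_union (X σ : Finset α) : F.lab X = F.lab (X ∪ σ) ∨ F.lab X = 0 ∨ F.lab (X ∪ σ) = 4 :=
  F.lab_mono subset_union_left

/-! ## The three trace cases as sums over `partsOf S₀ᶜ` -/

section cases

variable [Fintype α] {F} {S₀ : Finset α} (h : F.IsOrPetal S₀)
include h

/-- Case (iii): all three traces nonempty — every term vanishes. [this work] -/
theorem traceSum_three_eq_zero {σ₁ σ₂ σ₃ : Finset α} (h₁ : σ₁ ⊆ S₀) (h₂ : σ₂ ⊆ S₀) (h₃ : σ₃ ⊆ S₀)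
    (n₁ : σ₁.Nonempty) (n₂ : σ₂.Nonempty) (n₃ : σ₃.Nonempty) :
    ∑ r ∈ partsOf S₀ᶜ, s6H (F.lab (r.1 ∪ σ₁)) (F.lab (r.2 ∪ σ₂)) (F.lab ((S₀ᶜ \ (r.1 ∪ r.2)) ∪ σ₃)) = 0 :=
  sum_eq_zero fun _ _ => s6H_eq_zero_of_ge3 _ _ _ (lab_union_ge_three h h₁ n₁ _) (lab_union_ge_three h h₂ n₂ _)
    (lab_union_ge_three h h₃ n₃ _)

/-- Case (ii), canonical position: first block free, `σ, τ ≠ ∅`. [this work] -/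
theorem traceSum_two_nonneg {σ τ : Finset α} (hσ : σ ⊆ S₀) (hτ : τ ⊆ S₀) (nσ : σ.Nonempty) (nτ : τ.Nonempty) :
    0 ≤ ∑ r ∈ partsOf S₀ᶜ, s6H (F.lab r.1) (F.lab (r.2 ∪ σ)) (F.lab ((S₀ᶜ \ (r.1 ∪ r.2)) ∪ τ)) := by
  have hW : Disjoint S₀ᶜ S₀ := disjoint_compl_left
  have mem3 : ∀ r ∈ partsOf S₀ᶜ, r.1 ⊆ S₀ᶜ ∧ r.2 ⊆ S₀ᶜ ∧ S₀ᶜ \ (r.1 ∪ r.2) ⊆ S₀ᶜ := fun r hr => by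
    rw [mem_partsOf_iff] at hr
    exact ⟨hr.1, hr.2.1, sdiff_subset⟩
  -- indicator kernels (functions of the three blocks)
  let a : Finset α → Finset α → Finset α → ℤ := fun X Y Z =>
    if F.lab X = 0 ∧ F.lab (Y ∪ σ) = 4 ∧ F.lab (Z ∪ τ) = 4 then 1 else 0
  let b₁ : Finset α → Finset α → Finset α → ℤ := fun X Y Z =>
    if (F.lab X = 1 ∨ F.lab X = 2) ∧ F.lab (Y ∪ σ) = 4 ∧ F.lab Z = 0 then 1 else 0
  let b₂ : Finset α → Finset α → Finset α → ℤ := fun X Y Z =>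
    if (F.lab X = 1 ∨ F.lab X = 2) ∧ F.lab (Z ∪ τ) = 4 ∧ F.lab Y = 0 then 1 else 0
  let c₁ : Finset α → Finset α → Finset α → ℤ := fun X Y Z =>
    if F.lab Z ≠ 0 ∧ F.lab Z ≠ 3 ∧ F.lab Z ≠ 4 ∧ F.lab (Y ∪ σ) = 4 ∧ F.lab X = 0 ∧ F.lab (Z ∪ τ) = 4 then 1 else 0
  let c₂ : Finset α → Finset α → Finset α → ℤ := fun X Y Z =>
    if F.lab Y ≠ 0 ∧ F.lab Y ≠ 3 ∧ F.lab Y ≠ 4 ∧ F.lab (Z ∪ τ) = 4 ∧ F.lab X = 0 ∧ F.lab (Y ∪ σ) = 4 then 1 else 0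
  -- step 1: pointwise lower bound
  have step1 : ∑ r ∈ partsOf S₀ᶜ, (2 * a r.1 r.2 (S₀ᶜ \ (r.1 ∪ r.2)) - b₁ r.1 r.2 (S₀ᶜ \ (r.1 ∪ r.2)) - b₂ r.1 r.2 (S₀ᶜ \ (r.1 ∪ r.2)))
      ≤ ∑ r ∈ partsOf S₀ᶜ, s6H (F.lab r.1) (F.lab (r.2 ∪ σ)) (F.lab ((S₀ᶜ \ (r.1 ∪ r.2)) ∪ τ)) := by
    refine sum_le_sum fun r hr => ?_
    obtain ⟨m1, m2, m3⟩ := mem3 r hr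
    exact s6H_ge_case_two _ _ _ _ _ (lab_ne_three_of_subset h hW m1) (lab_ne_three_of_subset h hW m2) (lab_ne_three_of_subset h hW m3)
      (lab_union_ge_three h hσ nσ _) (lab_union_ge_three h hτ nτ _) (F.lab_mono_union _ _) (F.lab_mono_union _ _)
  -- step 2: move the debts by block swaps
  have step2a : ∑ r ∈ partsOf S₀ᶜ, b₁ r.1 r.2 (S₀ᶜ \ (r.1 ∪ r.2)) = ∑ r ∈ partsOf S₀ᶜ, b₁ (S₀ᶜ \ (r.1 ∪ r.2)) r.2 r.1 :=
    sum_partsOf_swap13 S₀ᶜ b₁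
  have step2b : ∑ r ∈ partsOf S₀ᶜ, b₂ r.1 r.2 (S₀ᶜ \ (r.1 ∪ r.2)) = ∑ r ∈ partsOf S₀ᶜ, b₂ r.2 r.1 (S₀ᶜ \ (r.1 ∪ r.2)) :=
    sum_partsOf_swap12 S₀ᶜ b₂
  -- step 3: a swapped debt sits inside a positive term
  have step3a : ∑ r ∈ partsOf S₀ᶜ, b₁ (S₀ᶜ \ (r.1 ∪ r.2)) r.2 r.1 ≤ ∑ r ∈ partsOf S₀ᶜ, c₁ r.1 r.2 (S₀ᶜ \ (r.1 ∪ r.2)) :=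
    sum_le_sum fun r _ =>
      case_two_move _ _ _ _ (lab_union_ge_three h hτ nτ (S₀ᶜ \ (r.1 ∪ r.2))) (F.lab_mono_union (S₀ᶜ \ (r.1 ∪ r.2)) τ)
  have step3b : ∑ r ∈ partsOf S₀ᶜ, b₂ r.2 r.1 (S₀ᶜ \ (r.1 ∪ r.2)) ≤ ∑ r ∈ partsOf S₀ᶜ, c₂ r.1 r.2 (S₀ᶜ \ (r.1 ∪ r.2)) :=
    sum_le_sum fun r _ => case_two_move _ _ _ _ (lab_union_ge_three h hσ nσ r.2) (F.lab_mono_union r.2 σ)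
  -- step 4: repayment
  have step4 : ∑ r ∈ partsOf S₀ᶜ, (c₁ r.1 r.2 (S₀ᶜ \ (r.1 ∪ r.2)) + c₂ r.1 r.2 (S₀ᶜ \ (r.1 ∪ r.2)))
      ≤ ∑ r ∈ partsOf S₀ᶜ, 2 * a r.1 r.2 (S₀ᶜ \ (r.1 ∪ r.2)) :=
    sum_le_sum fun r _ => case_two_repay _ _ _ _ _
  rw [sum_sub_distrib, sum_sub_distrib, ← mul_sum] at step1
  rw [sum_add_distrib, ← mul_sum] at step4
  linarith

/-- Case (i), canonical position: first two blocks free, the third carries all of `S₀`. [this work] -/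
theorem traceSum_one_nonneg :
    0 ≤ ∑ r ∈ partsOf S₀ᶜ, s6H (F.lab r.1) (F.lab r.2) (F.lab ((S₀ᶜ \ (r.1 ∪ r.2)) ∪ S₀)) := by
  have hW : Disjoint S₀ᶜ S₀ := disjoint_compl_left
  have nS : S₀.Nonempty := h.1
  have mem3 : ∀ r ∈ partsOf S₀ᶜ, r.1 ⊆ S₀ᶜ ∧ r.2 ⊆ S₀ᶜ ∧ S₀ᶜ \ (r.1 ∪ r.2) ⊆ S₀ᶜ := fun r hr => by
    rw [mem_partsOf_iff] at hr
    exact ⟨hr.1, hr.2.1, sdiff_subset⟩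
  -- indicator kernels of the three free parts
  let A1 : Finset α → Finset α → Finset α → ℤ := fun X Y Z => if F.lab X = 0 ∧ F.lab Y = 4 ∧ F.lab Z ≠ 0 then 1 else 0
  let A2 : Finset α → Finset α → Finset α → ℤ := fun X Y Z => if F.lab X = 4 ∧ F.lab Y = 0 ∧ F.lab Z ≠ 0 then 1 else 0
  let B : Finset α → Finset α → Finset α → ℤ := fun X Y Z => if F.lab X = 0 ∧ F.lab Y = 0 ∧ F.lab Z ≠ 0 then 1 else 0
  let P12 : Finset α → Finset α → Finset α → ℤ := fun X Y _ =>
    if F.lab X ≠ 0 ∧ F.lab X ≠ 4 ∧ F.lab Y ≠ 0 ∧ F.lab Y ≠ 4 ∧ F.lab X ≠ F.lab Y then 1 else 0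
  let D : Finset α → Finset α → Finset α → ℤ := fun X Y Z =>
    if (F.lab X = 1 ∨ F.lab X = 2) ∧ (F.lab Y = 0 ∨ F.lab Y = 4) ∧ F.lab Z = 0 then 1 else 0
  let E : Finset α → Finset α → Finset α → ℤ := fun X Y Z =>
    if (F.lab X = 0 ∨ F.lab X = 4) ∧ (F.lab Y = 1 ∨ F.lab Y = 2) ∧ F.lab Z = 0 then 1 else 0
  let K : Finset α → Finset α → Finset α → ℤ := fun X Y _ => kk (F.lab X) (F.lab Y)
  let H0a : Finset α → Finset α → Finset α → ℤ := fun X Y Z => if F.lab X = 4 ∧ F.lab Y = 0 ∧ F.lab Z = 0 then 1 else 0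
  let H0b : Finset α → Finset α → Finset α → ℤ := fun X Y Z => if F.lab X = 0 ∧ F.lab Y = 4 ∧ F.lab Z = 0 then 1 else 0
  let D1 : Finset α → Finset α → Finset α → ℤ := fun X Y Z => if (F.lab X = 1 ∨ F.lab X = 2) ∧ F.lab Y = 4 ∧ F.lab Z = 0 then 1 else 0
  let D2 : Finset α → Finset α → Finset α → ℤ := fun X Y Z => if (F.lab X = 1 ∨ F.lab X = 2) ∧ F.lab Y = 0 ∧ F.lab Z = 0 then 1 else 0
  let E1 : Finset α → Finset α → Finset α → ℤ := fun X Y Z => if F.lab X = 4 ∧ (F.lab Y = 1 ∨ F.lab Y = 2) ∧ F.lab Z = 0 then 1 else 0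
  let E2 : Finset α → Finset α → Finset α → ℤ := fun X Y Z => if F.lab X = 0 ∧ (F.lab Y = 1 ∨ F.lab Y = 2) ∧ F.lab Z = 0 then 1 else 0
  -- step 1: pointwise lower bound
  have step1 : ∑ r ∈ partsOf S₀ᶜ, (2 * A1 r.1 r.2 (S₀ᶜ \ (r.1 ∪ r.2)) + 2 * A2 r.1 r.2 (S₀ᶜ \ (r.1 ∪ r.2))
        + 2 * B r.1 r.2 (S₀ᶜ \ (r.1 ∪ r.2)) - P12 r.1 r.2 (S₀ᶜ \ (r.1 ∪ r.2)) - D r.1 r.2 (S₀ᶜ \ (r.1 ∪ r.2))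
        - E r.1 r.2 (S₀ᶜ \ (r.1 ∪ r.2)))
      ≤ ∑ r ∈ partsOf S₀ᶜ, s6H (F.lab r.1) (F.lab r.2) (F.lab ((S₀ᶜ \ (r.1 ∪ r.2)) ∪ S₀)) := by
    refine sum_le_sum fun r hr => ?_
    obtain ⟨m1, m2, m3⟩ := mem3 r hr
    exact s6H_ge_case_one _ _ _ _ (lab_ne_three_of_subset h hW m1) (lab_ne_three_of_subset h hW m2) (lab_ne_three_of_subset h hW m3)
      (lab_union_ge_three h subset_rfl nS _) (F.lab_mono_union _ _)
  -- step 2: the Gladkov loan `0 ≤ Σ kk (lab X) (lab Y)` (antipodal Gladkov behind every free third block, after a rotation)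
  have step2 : 0 ≤ ∑ r ∈ partsOf S₀ᶜ, K r.1 r.2 (S₀ᶜ \ (r.1 ∪ r.2)) := by
    rw [sum_partsOf_rot' S₀ᶜ K]
    exact F.sum_partsOf_kk_nonneg S₀ᶜ
  have splitK : ∑ r ∈ partsOf S₀ᶜ, K r.1 r.2 (S₀ᶜ \ (r.1 ∪ r.2)) = ∑ r ∈ partsOf S₀ᶜ,
      (A2 r.1 r.2 (S₀ᶜ \ (r.1 ∪ r.2)) + H0a r.1 r.2 (S₀ᶜ \ (r.1 ∪ r.2)) + A1 r.1 r.2 (S₀ᶜ \ (r.1 ∪ r.2)) + H0b r.1 r.2 (S₀ᶜ \ (r.1 ∪ r.2))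
        - P12 r.1 r.2 (S₀ᶜ \ (r.1 ∪ r.2))) :=
    sum_congr rfl fun r _ => kk_split _ _ _
  -- step 3: split and rotate the debts onto the third block
  have splitD : ∑ r ∈ partsOf S₀ᶜ, D r.1 r.2 (S₀ᶜ \ (r.1 ∪ r.2)) =
      ∑ r ∈ partsOf S₀ᶜ, (D1 r.1 r.2 (S₀ᶜ \ (r.1 ∪ r.2)) + D2 r.1 r.2 (S₀ᶜ \ (r.1 ∪ r.2))) :=
    sum_congr rfl fun r _ => debt_split_D _ _ _
  have splitE : ∑ r ∈ partsOf S₀ᶜ, E r.1 r.2 (S₀ᶜ \ (r.1 ∪ r.2)) =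
      ∑ r ∈ partsOf S₀ᶜ, (E1 r.1 r.2 (S₀ᶜ \ (r.1 ∪ r.2)) + E2 r.1 r.2 (S₀ᶜ \ (r.1 ∪ r.2))) :=
    sum_congr rfl fun r _ => debt_split_E _ _ _
  have rH0a : ∑ r ∈ partsOf S₀ᶜ, H0a r.1 r.2 (S₀ᶜ \ (r.1 ∪ r.2)) = ∑ r ∈ partsOf S₀ᶜ, H0a (S₀ᶜ \ (r.1 ∪ r.2)) r.1 r.2 :=
    sum_partsOf_rot S₀ᶜ H0a
  have rH0b : ∑ r ∈ partsOf S₀ᶜ, H0b r.1 r.2 (S₀ᶜ \ (r.1 ∪ r.2)) = ∑ r ∈ partsOf S₀ᶜ, H0b r.1 (S₀ᶜ \ (r.1 ∪ r.2)) r.2 :=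
    sum_partsOf_swap23 S₀ᶜ H0b
  have rD1 : ∑ r ∈ partsOf S₀ᶜ, D1 r.1 r.2 (S₀ᶜ \ (r.1 ∪ r.2)) = ∑ r ∈ partsOf S₀ᶜ, D1 (S₀ᶜ \ (r.1 ∪ r.2)) r.1 r.2 :=
    sum_partsOf_rot S₀ᶜ D1
  have rD2 : ∑ r ∈ partsOf S₀ᶜ, D2 r.1 r.2 (S₀ᶜ \ (r.1 ∪ r.2)) = ∑ r ∈ partsOf S₀ᶜ, D2 (S₀ᶜ \ (r.1 ∪ r.2)) r.1 r.2 :=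
    sum_partsOf_rot S₀ᶜ D2
  have rE1 : ∑ r ∈ partsOf S₀ᶜ, E1 r.1 r.2 (S₀ᶜ \ (r.1 ∪ r.2)) = ∑ r ∈ partsOf S₀ᶜ, E1 r.2 (S₀ᶜ \ (r.1 ∪ r.2)) r.1 :=
    sum_partsOf_rot' S₀ᶜ E1
  have rE2 : ∑ r ∈ partsOf S₀ᶜ, E2 r.1 r.2 (S₀ᶜ \ (r.1 ∪ r.2)) = ∑ r ∈ partsOf S₀ᶜ, E2 r.1 (S₀ᶜ \ (r.1 ∪ r.2)) r.2 :=
    sum_partsOf_swap23 S₀ᶜ E2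
  -- step 4: pointwise repayment of everything now positioned on the third block
  have step4 : ∑ r ∈ partsOf S₀ᶜ, (H0a (S₀ᶜ \ (r.1 ∪ r.2)) r.1 r.2 + H0b r.1 (S₀ᶜ \ (r.1 ∪ r.2)) r.2
        + D1 (S₀ᶜ \ (r.1 ∪ r.2)) r.1 r.2 + D2 (S₀ᶜ \ (r.1 ∪ r.2)) r.1 r.2
        + E1 r.2 (S₀ᶜ \ (r.1 ∪ r.2)) r.1 + E2 r.1 (S₀ᶜ \ (r.1 ∪ r.2)) r.2)
      ≤ ∑ r ∈ partsOf S₀ᶜ, (A1 r.1 r.2 (S₀ᶜ \ (r.1 ∪ r.2)) + A2 r.1 r.2 (S₀ᶜ \ (r.1 ∪ r.2)) + 2 * B r.1 r.2 (S₀ᶜ \ (r.1 ∪ r.2))) := by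
    refine sum_le_sum fun r hr => ?_
    obtain ⟨_, _, m3⟩ := mem3 r hr
    exact case_one_repay _ _ _ (lab_ne_three_of_subset h hW m3)
  rw [sum_sub_distrib, sum_sub_distrib, sum_sub_distrib, sum_add_distrib, sum_add_distrib, ← mul_sum, ← mul_sum, ← mul_sum] at step1
  rw [sum_sub_distrib, sum_add_distrib, sum_add_distrib, sum_add_distrib] at splitK
  rw [sum_add_distrib] at splitD splitE
  rw [sum_add_distrib, sum_add_distrib, sum_add_distrib, sum_add_distrib, sum_add_distrib] at step4
  rw [sum_add_distrib, sum_add_distrib, ← mul_sum] at step4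
  linarith [step1, step2, splitK, splitD, splitE, rH0a, rH0b, rD1, rD2, rE1, rE2, step4]

end cases

/-! ## Assembly -/

/-- `s6H` is invariant under swapping its first two arguments (from the tree's `s6H_symm`). [this work] -/
theorem s6H_swap12 (x y z : Fin 5) : s6H x y z = s6H y x z := (s6H_symm x y z).1

/-- `s6H` is invariant under swapping its last two arguments. [this work] -/
theorem s6H_swap23 (x y z : Fin 5) : s6H x y z = s6H x z y := (s6H_symm x y z).2

/-- **★ FOR EVERY SUNFLOWER WITH A DISJUNCTIVE PETAL (label `3`)**: if the petal `3` consists exactly of the non-kernel sets meeting a nonempty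
`S₀`, then `0 ≤ ZH`. [this work] -/
theorem ZH_nonneg_of_isOrPetal [Fintype α] {S₀ : Finset α} (h : F.IsOrPetal S₀) : 0 ≤ F.ZH := by
  unfold ZH
  rw [sum_parts_eq_sum_traces S₀]
  refine sum_nonneg fun s hs => ?_
  refine le_of_le_of_eq ?_ (sum_parts_trace_eq S₀ hs (fun P Q R => s6H (F.lab P) (F.lab Q) (F.lab R))).symm
  have hs' := hs
  rw [mem_partsOf_iff] at hs'
  obtain ⟨h1, h2, _⟩ := hs'
  set σ₃ := S₀ \ (s.1 ∪ s.2) with hσ₃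
  have h3 : σ₃ ⊆ S₀ := sdiff_subset
  -- the three traces cover S₀
  have cover : ∀ x ∈ S₀, x ∈ s.1 ∨ x ∈ s.2 ∨ x ∈ σ₃ := fun x hx => by
    by_cases ha : x ∈ s.1
    · exact Or.inl ha
    by_cases hb : x ∈ s.2
    · exact Or.inr (Or.inl hb)
    exact Or.inr (Or.inr (mem_sdiff.2 ⟨hx, fun hh => (mem_union.1 hh).elim ha hb⟩))
  by_cases e1 : s.1 = ∅ <;> by_cases e2 : s.2 = ∅ <;> by_cases e3 : σ₃ = ∅
  · -- all three traces empty: impossible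
    exfalso
    obtain ⟨x, hx⟩ := h.1
    rcases cover x hx with hh | hh | hh
    · rw [e1] at hh; exact (notMem_empty x) hh
    · rw [e2] at hh; exact (notMem_empty x) hh
    · rw [e3] at hh; exact (notMem_empty x) hh
  · -- only the third trace nonempty: case (i), canonical position
    have e3' : σ₃ = S₀ := by rw [hσ₃, e1, e2, empty_union, sdiff_empty]
    rw [e3', e1, e2]
    simp only [union_empty]
    exact traceSum_one_nonneg h
  · -- only the second trace nonempty: case (i) with `S₀` in the second block
    have hs2 : s.2 = S₀ := by
      refine Subset.antisymm h2 fun x hx => ?_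
      rcases cover x hx with hh | hh | hh
      · rw [e1] at hh; exact ((notMem_empty x) hh).elim
      · exact hh
      · rw [e3] at hh; exact ((notMem_empty x) hh).elim
    rw [e3, e1, hs2]
    simp only [union_empty]
    have e := sum_partsOf_swap23 S₀ᶜ (fun a b c => s6H (F.lab a) (F.lab (b ∪ S₀)) (F.lab c))
    beta_reduce at e
    rw [e]
    refine le_of_le_of_eq (traceSum_one_nonneg h) (sum_congr rfl fun r _ => ?_)
    exact s6H_swap23 _ _ _
  · -- second and third nonempty, first empty: case (ii), canonical position
    have n2 : s.2.Nonempty := nonempty_iff_ne_empty.2 e2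
    have n3 : σ₃.Nonempty := nonempty_iff_ne_empty.2 e3
    rw [e1]
    simp only [union_empty]
    exact traceSum_two_nonneg h h2 h3 n2 n3
  · -- only the first trace nonempty: case (i) with `S₀` in the first block
    have hs1 : s.1 = S₀ := by
      refine Subset.antisymm h1 fun x hx => ?_
      rcases cover x hx with hh | hh | hh
      · exact hh
      · rw [e2] at hh; exact ((notMem_empty x) hh).elim
      · rw [e3] at hh; exact ((notMem_empty x) hh).elim
    rw [e3, e2, hs1]
    simp only [union_empty]
    have e := sum_partsOf_swap13 S₀ᶜ (fun a b c => s6H (F.lab (a ∪ S₀)) (F.lab b) (F.lab c))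
    beta_reduce at e
    rw [e]
    refine le_of_le_of_eq (traceSum_one_nonneg h) (sum_congr rfl fun r _ => ?_)
    rw [s6H_swap12, s6H_swap23, s6H_swap12]
  · -- first and third nonempty, second empty: case (ii), free block second
    have n1 : s.1.Nonempty := nonempty_iff_ne_empty.2 e1
    have n3 : σ₃.Nonempty := nonempty_iff_ne_empty.2 e3
    rw [e2]
    simp only [union_empty]
    have e := sum_partsOf_swap12 S₀ᶜ (fun a b c => s6H (F.lab (a ∪ s.1)) (F.lab b) (F.lab (c ∪ σ₃)))
    beta_reduce at e
    rw [e]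
    refine le_of_le_of_eq (traceSum_two_nonneg h h1 h3 n1 n3) (sum_congr rfl fun r _ => ?_)
    exact s6H_swap12 _ _ _
  · -- first and second nonempty, third empty: case (ii), free block third
    have n1 : s.1.Nonempty := nonempty_iff_ne_empty.2 e1
    have n2 : s.2.Nonempty := nonempty_iff_ne_empty.2 e2
    rw [e3]
    simp only [union_empty]
    have e := sum_partsOf_swap13 S₀ᶜ (fun a b c => s6H (F.lab (a ∪ s.1)) (F.lab (b ∪ s.2)) (F.lab c))
    beta_reduce at e
    rw [e]
    refine le_of_le_of_eq (traceSum_two_nonneg h h2 h1 n2 n1) (sum_congr rfl fun r _ => ?_)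
    rw [s6H_swap12, s6H_swap23, s6H_swap12, s6H_swap23]
  · -- all three nonempty: case (iii)
    have n1 : s.1.Nonempty := nonempty_iff_ne_empty.2 e1
    have n2 : s.2.Nonempty := nonempty_iff_ne_empty.2 e2
    have n3 : σ₃.Nonempty := nonempty_iff_ne_empty.2 e3
    exact le_of_eq (traceSum_three_eq_zero h h1 h2 h3 n1 n2 n3).symm

/-- **★ for a disjunctive petal of ANY label `ℓ ∈ {1,2,3}`** (cyclic relabelling `rotate`, `rotate_ZH`, `lab_rotate` of `…SunflowerPrincipalPetal`).
[this work] -/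
theorem ZH_nonneg_of_orPetal_label [Fintype α] (ℓ : Fin 5) (hℓ : ℓ = 1 ∨ ℓ = 2 ∨ ℓ = 3) {S₀ : Finset α} (hne : S₀.Nonempty)
    (h1 : ∀ S : Finset α, (S ∩ S₀).Nonempty → F.lab S = ℓ ∨ F.lab S = 4) (h2 : ∀ S : Finset α, F.lab S = ℓ → (S ∩ S₀).Nonempty) :
    0 ≤ F.ZH := by
  rcases hℓ with rfl | rfl | rfl
  · -- label `1`: rotate once (`rot5 1 = 3`)
    rw [← F.rotate_ZH]
    refine F.rotate.ZH_nonneg_of_isOrPetal (S₀ := S₀) ⟨hne, fun S hS => ?_, fun S hS => h2 S ?_⟩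
    · rw [F.lab_rotate]
      rcases h1 S hS with e | e <;> rw [e] <;> decide
    · rw [F.lab_rotate] at hS
      revert hS; generalize F.lab S = x; revert x; decide
  · -- label `2`: rotate twice
    rw [← F.rotate_ZH, ← F.rotate.rotate_ZH]
    refine F.rotate.rotate.ZH_nonneg_of_isOrPetal (S₀ := S₀) ⟨hne, fun S hS => ?_, fun S hS => h2 S ?_⟩
    · rw [F.rotate.lab_rotate, F.lab_rotate]
      rcases h1 S hS with e | e <;> rw [e] <;> decide
    · rw [F.rotate.lab_rotate, F.lab_rotate] at hS
      revert hS; generalize F.lab S = x; revert x; decide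
  · exact F.ZH_nonneg_of_isOrPetal ⟨hne, h1, h2⟩

end Sunflower


end Summit.CriticalPhenomena.PercolationContinuityZ3.Theorems.SunflowerPartition
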